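import Summits.BirchSwinnertonDyer.Rank1Residual.ManinAdditive.MinusOneLevelRaisingOptimalPartnerProof
import Summits.BirchSwinnertonDyer.BirchSwinnertonDyer.Theses.ManinLocalTwoThree
import Literature.NumberTheory.EllipticCurves.CuspFormLFunctionLevelConductorProofs
import HarnessLib

/-!
# Route `ManinLocalTwoThree`, crux C2 `ManinOddAtFour` (stmt-BirchSwinnertonDyer-22967): THE `8 ∣ N` SPLIT
# `ManinOddAtEight → NegOneTwistConductorFourMul → ManinOddAtFour` (cell bsd-f2-manin, seat -an, gen 32, MEMO-an §75.9)

C2 quantifies over optimal `X₀(N)`-data of a globally minimal `W/ℚ` at an ARBITRARY level `N` with `4 ∣ N`.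
Strong multiplicity one across levels (`IsNewformOf.level_eq_level`, Atkin–Lehner 1970 Thm. 4, a theorem of the
tree) and the frame hypothesis `exists_isNewformOf` pin `N = N(W)`; the conductor-level stratum theorem
`two_not_dvd_c_of_four_dvd_of_eight_dvd_stratum_of_modularity` (file `MinusOneLevelRaisingOptimalPartnerProof`:
every lattice-optimal datum with `4 ∥ N` has a lattice-optimal `χ₋₄`-partner at conductor `4N` with Manin constant
`± c`, by the level-raising rotation `Λ(f ⊗ χ₋₄) = i·Λ(f)` E-an-145 and Connell–Pal) then reduces the `4 ∥ N`
stratum to the `8 ∣ N` stratum.  Hence C2 splits, in the kernel, into its own restriction `ManinOddAtEight`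
(open) and the print fact `NegOneTwistConductorFourMul` (S-an-58: `f₂ = 2 ⇒ N(W ⊗ χ₋₄) = 4·N(W)`,
Barrios et al. 2025 Thm. 5.1, Table `localdata-dodd`, rows IV / IV*, `d ≡ 3 (mod 4)`; Serre, tame ⊗ wild).
The converse `ManinOddAtFour → ManinOddAtEight` is trivial, so nothing is lost.
PARTITION 0 · C2 is NOT proved here (`ManinOddAtEight` is open) · BSD is not proved by this; Manin's conjecture is
not proved by this.  References: [AtkinLehner1970] Thm. 4; [BarriosEtAl2025] Thm. 5.1; [CesnaviciusNeururerSaha2023].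

TYPER NOTE (typer g17, TURNKEY-an-24 B4).  Landed VERBATIM from HOME/an/g32/MinusOneLevelRaisingManinOddAtFourSplit.lean
sha16 3d5533fbe6ccbaab (79 l.; §8 of the -an seat's kernel-certified scratch MinusOneLevelRaisingAll.lean c17acbedb3e2e0fd,
farm rc 0 · 0 err · 0 warn · 0 sorry, axioms standard; by name vs the tree: MinusOneLevelRaisingProofs_concat4.lean
d9efae78a3ec786a rc 0; ref1 §R125: kernel theorem re-run independently, S-an-59 = C2 verbatim but `2 ^ 3`, BC7 CLEAN)
except this note and the Barrios reference key.  ONE new `def … : Prop`: **S-an-59 `ManinOddAtEight`** (= the crux C2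
`Theses.ManinLocalTwoThree.ManinOddAtFour` restricted to `8 ∣ N`; OPEN — an obligation-shaped restriction, not a
conjecture of its own and not a Literature fact).  The split theorem is `proof.conditional` glue for stmt-22967; the
ROUTE-LEVEL split (`--split ManinOddAtFour --into ManinOddAtEight NegOneTwistConductorFourMul`) is the C2 LEAD's call
and is NOT performed by this file.  BSD is not proved by this; Manin's conjecture is not proved by this; C2/C3 OPEN.
-/

set_option autoImplicit false

noncomputable section

open WeierstrassCurve
  Literature.NumberTheory.DiophantineGeometry
  Literature.NumberTheory.EllipticCurves
  Literature.NumberTheory.EllipticCurves.ModularForms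

namespace Summit.BirchSwinnertonDyer.Rank1Residual.ManinAdditive

section Split

/-- **C2 restricted to `8 ∣ N`** — verbatim `ManinOddAtFour` (Theses/ManinLocalTwoThree.lean, stmt-22967) with
`2 ^ 3 ∣ N` in place of `2 ^ 2 ∣ N`; same four frame hypotheses, same lattice-optimality clause. -/
def ManinOddAtEight : Prop :=
  mazur_not_dvd_maninConstant_of_odd → abbesUllmo_not_dvd_maninConstant_of_not_dvd_level →
    cesnavicius_not_two_dvd_maninConstant_of_two_dvd_level → exists_isNewformOf →
    ∀ (W : WeierstrassCurve ℚ) [W.IsElliptic] [W.IsGloballyMinimal] {N : ℕ} [NeZero N]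
      (D : ModularParametrizationData W N),
      (∀ z ∈ D.L.lattice, ∃ w ∈ periodLattice D.f, z = D.c * w) → 2 ^ 3 ∣ N → ¬ (2 : ℤ) ∣ D.maninConstant

/-- **THE SPLIT (kernel): `ManinOddAtEight → NegOneTwistConductorFourMul → ManinOddAtFour`.**  Given the frame
hypotheses of C2, a datum `D` of `W` at level `N` has `N = N(W)` (`IsNewformOf.level_eq_level` against the
newform supplied by `exists_isNewformOf`); then `two_not_dvd_c_of_four_dvd_of_eight_dvd_stratum_of_modularity`
(§7: the lattice-optimal `χ₋₄`-partner at conductor `4N` with the same Manin constant up to sign, E-an-145R)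
reduces `4 ∥ N` to `8 ∣ N`, and `8 ∣ N` is the hypothesis `ManinOddAtEight` itself. -/
theorem maninOddAtFour_of_maninOddAtEight (h58 : NegOneTwistConductorFourMul) (h8 : ManinOddAtEight) :
    Summit.BirchSwinnertonDyer.BirchSwinnertonDyer.Theses.ManinLocalTwoThree.ManinOddAtFour := by
  intro hMz hAU hCs hnf W _ _ N _ D hD h4
  haveI : NeZero (W.conductorNorm ℤ) := ⟨(W.conductorNorm_pos_holds).ne'⟩
  obtain ⟨g, hg⟩ := hnf W
  have hN : N = W.conductorNorm ℤ := IsNewformOf.level_eq_level D.isNewformOf hg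
  subst hN
  refine two_not_dvd_c_of_four_dvd_of_eight_dvd_stratum_of_modularity hnf h58 ?_ W D hD h4
  intro W' _ _ _ D' hD' h8'
  exact h8 hMz hAU hCs hnf W' D' hD' h8'

/-- The split read as a conjunction: `(ManinOddAtEight ∧ NegOneTwistConductorFourMul) → ManinOddAtFour`. -/
theorem maninOddAtFour_of_and (h : ManinOddAtEight ∧ NegOneTwistConductorFourMul) :
    Summit.BirchSwinnertonDyer.BirchSwinnertonDyer.Theses.ManinLocalTwoThree.ManinOddAtFour :=
  maninOddAtFour_of_maninOddAtEight h.2 h.1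

/-- Conversely `ManinOddAtFour → ManinOddAtEight` trivially (`2 ^ 3 ∣ N → 2 ^ 2 ∣ N`): the split loses nothing. -/
theorem maninOddAtEight_of_maninOddAtFour
    (h : Summit.BirchSwinnertonDyer.BirchSwinnertonDyer.Theses.ManinLocalTwoThree.ManinOddAtFour) :
    ManinOddAtEight := by
  intro hMz hAU hCs hnf W _ _ N _ D hD h8
  exact h hMz hAU hCs hnf W D hD (dvd_trans ⟨2, by norm_num⟩ h8)

end Split

end Summit.BirchSwinnertonDyer.Rank1Residual.ManinAdditive

end
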